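import Literature.AnabelianGeometry.AbsoluteAnabelian.TateModuleRestrictionKummer
import HarnessLib

/-!
# `H¹(res; Ẑ(1))` under `H¹(G_K, Ẑ(1)) ≃ (Kˣ)^∧` is the completion of `Fˣ ⊆ Eˣ`

abc-iut cell, layer L4, row «COR110ib-OPEN» (abc-iut-L4-t11; L4-lead RULING #6g) — square (S2) of the
open-injective functoriality of [AbsTopIII] Cor. 1.10 (i)(b) p. 42 (S. Mochizuki, *Topics in Absolute
Anabelian Geometry III*: the isomorphism `H¹(G_k, μ_Ẑ(G_k)) ⥲ G_k^ab` is Kummer theory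
`H¹(G_k, Ẑ(1)) = (kˣ)^∧` followed by local class field theory; its «functoriality … with respect to
arbitrary injective open homomorphisms»).  For a finite extension `E/F` of fields of characteristic `0`
whose power classes `Kˣ/(Kˣ)ⁿ` are finite (e.g. MLFs), this proof-only file identifies the restriction
`H¹(res; Ẑ(1)(ι)) : H¹(Γ_F, Ẑ(1)(F̄)) → H¹(Γ_E, Ẑ(1)(Ē))` (any coefficient morphism `f` over `res` that is
`ι` coordinatewise, `TateModuleRestrictionKummer.lean`) with the map of profinite completions
`Ψ : (Fˣ)^∧ → (Eˣ)^∧` induced by `Fˣ ⊆ Eˣ`, under abc-iut-L4-t11's Kummer isomorphisms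
`continuousCohomologyOneTateModuleEquivCompletion K : H¹_cont(Γ_K, Ẑ(1)) ≃+ (Kˣ)^∧`
(`TateModuleKummerCompletion.lean`):

* `PowCompletion.proj_eta`, `PowCompletion.continuous_proj`, `PowCompletion.proj_eq_of_eta` — the power
  components `(Kˣ)^∧ → Kˣ/(Kˣ)ⁿ` (`PowCompletion.proj`) are continuous for the discrete topology, so a
  CONTINUOUS `Ψ` with `Ψ ∘ η = η ∘ (Fˣ ⊆ Eˣ)` (abc-iut-L4-d3's binder shape) has power components
  `proj_n (Ψ z) = (proj_n z read in Eˣ/(Eˣ)ⁿ)` (density of `η(Fˣ)`);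
* `map_resCoeff_kummerLift` — finite level on the quotients: `Res (δ_n q) = δ_n (q read in Eˣ)`;
* `cohomologyMap_projHom_completionEquiv_symm` — the `n`-th coordinate of the class attached to
  `z ∈ (Kˣ)^∧` is `δ_n (proj_n z)`;
* **`completionEquiv_map_tate`** — the square (S2): for every such `Ψ`,
  `Ψ_E (H¹(res; f) x) = Ψ (Ψ_F x)` with `Ψ_K = continuousCohomologyOneTateModuleEquivCompletion K`.

Theorems only (no definition, no named fact, no `sorry`).  HONEST FRAMING: Kummer theory; nothing here
bears on [IUTchIII] Cor. 3.12 or takes a side.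
-/

noncomputable section

open CategoryTheory Function
open Field
open ProfiniteGrp ProfiniteGrp.ProfiniteCompletion

universe u

namespace Literature.NumberTheory.GaloisRepresentations

/-! ### Power components of the profinite completion: `η`, continuity, density -/

namespace PowCompletion

variable {A : Type u} [CommGroup A]
variable (hfin : ∀ n : ℕ+, ((powMonoidHom (n : ℕ) : A →* A).range).FiniteIndex)

/-- The power components of `η(a)` are the classes of `a`: `proj_n (η a) = a (Aⁿ)`.
[cite: RibesZalesskii2010, Thm 2.7.1] -/
theorem proj_eta (n : ℕ+) (a : A) : proj hfin n (etaFn (GrpCat.of A) a) = QuotientGroup.mk a := rfl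

/-- The power component `Â → A/Aⁿ` is continuous for the discrete topology on the finite quotient (it is a
coordinate of the limit `Â = lim A/H`). [cite: RibesZalesskii2010, Thm 2.7.1] -/
theorem continuous_proj (n : ℕ+) :
    @Continuous _ _ _ (⊥ : TopologicalSpace (A ⧸ (powMonoidHom (n : ℕ) : A →* A).range))
      (proj hfin n) := by
  letI : TopologicalSpace (A ⧸ (powMonoidHom (n : ℕ) : A →* A).range) := ⊥
  exact ((limitCone (diagram (GrpCat.of A))).π.app (powLevel hfin n)).hom.continuous_toFun

variable {B : Type u} [CommGroup B]
variable (hfinB : ∀ n : ℕ+, ((powMonoidHom (n : ℕ) : B →* B).range).FiniteIndex)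

/-- A group homomorphism `g : A → B` maps `Aⁿ` into `Bⁿ` (image form; the `comap` form is
abc-iut-L4-d3's `Cor110Nat.range_pow_le_comap`, universe `0`). [cite: RibesZalesskii2010, Thm 2.7.1] -/
theorem map_range_pow_le (g : A →* B) (n : ℕ) :
    ((powMonoidHom n : A →* A).range).map g ≤ (powMonoidHom n : B →* B).range := by
  rintro _ ⟨_, ⟨a, rfl⟩, rfl⟩
  exact ⟨g a, by rw [powMonoidHom_apply, powMonoidHom_apply, map_pow]⟩

/-- **The power components of a continuous `Ψ : Â → B̂` over `g : A → B`** (`Ψ ∘ η_A = η_B ∘ g`):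
`proj_n (Ψ z) = g (proj_n z)` in `B/Bⁿ` — both sides are continuous into the discrete `B/Bⁿ`
(`continuous_proj`) and agree on the dense `η(A)` (`ProfiniteCompletion.denseRange`).
[cite: RibesZalesskii2010, Thm 2.7.1] -/
theorem proj_eq_of_eta {Ψ : completion (GrpCat.of A) →ₜ* completion (GrpCat.of B)} (g : A →* B)
    (hΨ : ∀ a : A, Ψ (etaFn (GrpCat.of A) a) = etaFn (GrpCat.of B) (g a))
    (z : completion (GrpCat.of A)) (n : ℕ+) :
    proj hfinB n (Ψ z) =
      QuotientGroup.map _ _ g (Subgroup.map_le_iff_le_comap.mp (map_range_pow_le g n)) (proj hfin n z) := by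
  letI : TopologicalSpace (B ⧸ (powMonoidHom (n : ℕ) : B →* B).range) := ⊥
  haveI : DiscreteTopology (B ⧸ (powMonoidHom (n : ℕ) : B →* B).range) := ⟨rfl⟩
  letI : TopologicalSpace (A ⧸ (powMonoidHom (n : ℕ) : A →* A).range) := ⊥
  haveI : DiscreteTopology (A ⧸ (powMonoidHom (n : ℕ) : A →* A).range) := ⟨rfl⟩
  have hc₁ : Continuous fun y => proj hfinB n (Ψ y) := (continuous_proj hfinB n).comp Ψ.continuous
  have hc₂ : Continuous fun y =>
      QuotientGroup.map _ _ g (Subgroup.map_le_iff_le_comap.mp (map_range_pow_le g n)) (proj hfin n y) :=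
    continuous_of_discreteTopology.comp (continuous_proj hfin n)
  have heq := (denseRange (GrpCat.of A)).equalizer hc₁ hc₂ (funext fun a => by
    change proj hfinB n (Ψ (etaFn (GrpCat.of A) a)) =
      QuotientGroup.map _ _ g (Subgroup.map_le_iff_le_comap.mp (map_range_pow_le g n)) (proj hfin n (etaFn (GrpCat.of A) a))
    rw [hΨ, proj_eta, proj_eta, QuotientGroup.map_mk])
  exact congrFun heq z

end PowCompletion

end Literature.NumberTheory.GaloisRepresentations

namespace Literature.AnabelianGeometry.AbsoluteAnabelian

open _root_.TopRep _root_.ContRepresentation _root_.ContinuousCohomology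
open Literature.NumberTheory.GaloisRepresentations
open Literature.NumberTheory.GaloisRepresentations.DiscreteGaloisModule

/-! ### Finite level on the quotients `Kˣ/(Kˣ)ⁿ` -/

section Finite

variable (F E : Type u) [Field F] [Field E] [Algebra F E] (n : ℕ) [NeZero (n : F)] [NeZero (n : E)]

/-- `Res (δ_n q) = δ_n (q)` for `q ∈ Fˣ/(Fˣ)ⁿ` read in `Eˣ/(Eˣ)ⁿ` (Kummer isomorphisms on the quotients,
tree `kummerLift`; from `map_resCoeff_kummerMap`). [cite: SerreGaloisCohomology1997, II §1.2] -/
theorem map_resCoeff_kummerLift (q : Fˣ ⧸ (powMonoidHom n : Fˣ →* Fˣ).range) :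
    ContinuousCohomology.map (absGaloisRestrict F E) (Prop121vii.resCoeff F E n) 1
        (Multiplicative.toAdd (kummerLift F n q)) =
      Multiplicative.toAdd (kummerLift E n (QuotientGroup.map _ _ (Units.map (algebraMap F E : F →* E))
        (Subgroup.map_le_iff_le_comap.mp (PowCompletion.map_range_pow_le (Units.map (algebraMap F E : F →* E)) n)) q)) := by
  obtain ⟨a, rfl⟩ := QuotientGroup.mk_surjective q
  rw [QuotientGroup.map_mk, kummerLift_mk, kummerLift_mk]
  exact map_resCoeff_kummerMap F E n a

end Finite

/-! ### The square (S2) -/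

section Completion

variable {F E : Type u} [Field F] [Field E] [Algebra F E] [CharZero F] [CharZero E]
variable (hfinF : ∀ n : ℕ+, ((powMonoidHom (n : ℕ) : Fˣ →* Fˣ).range).FiniteIndex)
  (hfinE : ∀ n : ℕ+, ((powMonoidHom (n : ℕ) : Eˣ →* Eˣ).range).FiniteIndex)

/-- `Ψ_K` spelled out: `Ψ_K y = (Kummer coordinates)⁻¹ (levels of y)`.
[cite: NeukirchSchmidtWingberg2008, II §7 Thm 2.7.5] -/
theorem continuousCohomologyOneTateModuleEquivCompletion_apply (K : Type u) [Field K] [CharZero K]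
    (hfin : ∀ n : ℕ+, ((powMonoidHom (n : ℕ) : Kˣ →* Kˣ).range).FiniteIndex)
    (y : continuousCohomology 1 (tateModuleMu K).toTopRep) :
    continuousCohomologyOneTateModuleEquivCompletion K hfin y =
      Additive.ofMul ((completionUnitsEquivCohomologyLimitMu K hfin).symm
        (Multiplicative.ofAdd (continuousCohomologyOneTateModuleEquiv K y))) :=
  rfl

/-- The inverse: the class attached to `z ∈ (Kˣ)^∧` is the class with Kummer coordinates those of `z`.
[cite: NeukirchSchmidtWingberg2008, II §7 Thm 2.7.5] -/
theorem continuousCohomologyOneTateModuleEquivCompletion_symm_apply (K : Type u) [Field K] [CharZero K]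
    (hfin : ∀ n : ℕ+, ((powMonoidHom (n : ℕ) : Kˣ →* Kˣ).range).FiniteIndex)
    (z : completion (GrpCat.of Kˣ)) :
    (continuousCohomologyOneTateModuleEquivCompletion K hfin).symm (Additive.ofMul z) =
      (continuousCohomologyOneTateModuleEquiv K).symm
        (Multiplicative.toAdd (completionUnitsEquivCohomologyLimitMu K hfin z)) := by
  apply (continuousCohomologyOneTateModuleEquivCompletion K hfin).injective
  rw [AddEquiv.apply_symm_apply, continuousCohomologyOneTateModuleEquivCompletion_apply,
    AddEquiv.apply_symm_apply, ofAdd_toAdd, MulEquiv.symm_apply_apply]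

/-- **Coordinates of the class attached to `z ∈ (Kˣ)^∧`**: its image in `H¹(Γ_K, μ_n)` is the Kummer class
`δ_n (proj_n z)` of the `n`-th power component of `z`. [cite: SerreGaloisCohomology1997, II §1.2] -/
theorem cohomologyMap_projHom_completionEquiv_symm (K : Type u) [Field K] [CharZero K]
    (hfin : ∀ n : ℕ+, ((powMonoidHom (n : ℕ) : Kˣ →* Kˣ).range).FiniteIndex)
    (z : completion (GrpCat.of Kˣ)) (n : ℕ+) :
    cohomologyMap ((muSystem K).projHom n) 1
        ((continuousCohomologyOneTateModuleEquivCompletion K hfin).symm (Additive.ofMul z)) =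
      Multiplicative.toAdd (kummerLift K n (PowCompletion.proj hfin n z)) := by
  rw [continuousCohomologyOneTateModuleEquivCompletion_symm_apply]
  change ((continuousCohomologyOneTateModuleEquiv K ((continuousCohomologyOneTateModuleEquiv K).symm
      (Multiplicative.toAdd (completionUnitsEquivCohomologyLimitMu K hfin z))) :
      (muSystem K).cohomologyLimit 1) : ∀ n, continuousCohomology 1 ((muSystem K).ρ n).toTopRep) n = _
  rw [AddEquiv.apply_symm_apply]
  rfl

variable (f : TopRep.res (absGaloisRestrict F E : absoluteGaloisGroup E →* absoluteGaloisGroup F)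
    (tateModuleMu F).toTopRep ⟶ (tateModuleMu E).toTopRep)
  (hf : ∀ (x : (muSystem F).limit) (n : ℕ+),
    ((f.hom x : (muSystem E).limit) : ∀ n : ℕ+, MuCarrier E n) n =
      Prop121vii.muRes F E n ((x : ∀ n : ℕ+, MuCarrier F n) n))
include hf

/-- **Square (S2), algebraic form**: for `Ψ : (Fˣ)^∧ → (Eˣ)^∧` whose power components are those of
`Fˣ ⊆ Eˣ` (`proj_n (Ψ z) = proj_n z` read in `Eˣ/(Eˣ)ⁿ`) and the coefficient morphism `f` over `res` that is
`ι` coordinatewise, the restriction `H¹(res; f)` on `H¹_cont(Γ_F, Ẑ(1))` is `Ψ` under the Kummer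
isomorphisms `Ψ_K : H¹_cont(Γ_K, Ẑ(1)) ≃+ (Kˣ)^∧`: `Ψ_E (H¹(res; f) x) = Ψ (Ψ_F x)` — both classes have
`n`-th coordinate `δ_n (proj_n (Ψ_F x))` read in `E` (`cohomologyMap_projHom_map_tate`,
`map_resCoeff_kummerLift`, `cohomologyMap_projHom_completionEquiv_symm`).
[cite: MochizukiAbsTopIII2015, Cor 1.10 (i) p.42] -/
theorem completionEquiv_map_tate_of_proj
    (Ψ : completion (GrpCat.of Fˣ) → completion (GrpCat.of Eˣ))
    (hΨ : ∀ (z : completion (GrpCat.of Fˣ)) (n : ℕ+),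
      PowCompletion.proj hfinE n (Ψ z) =
        QuotientGroup.map _ _ (Units.map (algebraMap F E : F →* E))
          (Subgroup.map_le_iff_le_comap.mp (PowCompletion.map_range_pow_le (Units.map (algebraMap F E : F →* E)) n))
          (PowCompletion.proj hfinF n z))
    (x : continuousCohomology 1 (tateModuleMu F).toTopRep) :
    continuousCohomologyOneTateModuleEquivCompletion E hfinE
        (ContinuousCohomology.map (absGaloisRestrict F E) f 1 x) =
      Additive.ofMul (Ψ (Additive.toMul (continuousCohomologyOneTateModuleEquivCompletion F hfinF x))) := by
  -- write `x = Ψ_F⁻¹ z`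
  set z : completion (GrpCat.of Fˣ) :=
    Additive.toMul (continuousCohomologyOneTateModuleEquivCompletion F hfinF x) with hz
  have hx : x = (continuousCohomologyOneTateModuleEquivCompletion F hfinF).symm (Additive.ofMul z) := by
    rw [hz, ofMul_toMul, AddEquiv.symm_apply_apply]
  rw [hx]
  apply (continuousCohomologyOneTateModuleEquivCompletion E hfinE).symm.injective
  rw [AddEquiv.symm_apply_apply]
  -- compare coordinates in `lim_n H¹(Γ_E, μ_n)`
  apply (continuousCohomologyOneTateModuleEquiv E).injective
  refine Subtype.ext (funext fun n => ?_)
  change cohomologyMap ((muSystem E).projHom n) 1 (ContinuousCohomology.map (absGaloisRestrict F E) f 1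
      ((continuousCohomologyOneTateModuleEquivCompletion F hfinF).symm (Additive.ofMul z))) =
    cohomologyMap ((muSystem E).projHom n) 1
      ((continuousCohomologyOneTateModuleEquivCompletion E hfinE).symm (Additive.ofMul (Ψ z)))
  rw [cohomologyMap_projHom_map_tate f hf, cohomologyMap_projHom_completionEquiv_symm,
    cohomologyMap_projHom_completionEquiv_symm, hΨ]
  exact map_resCoeff_kummerLift F E n _

/-- **Square (S2) of «COR110ib-OPEN»**: for a CONTINUOUS `Ψ : (Fˣ)^∧ → (Eˣ)^∧` over `Fˣ ⊆ Eˣ`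
(`Ψ ∘ η = η ∘ incl`, abc-iut-L4-d3's binder shape) and any coefficient morphism `f` over `res` that is `ι`
coordinatewise, `Ψ_E (H¹(res; Ẑ(1)(ι)) x) = Ψ (Ψ_F x)`: the restriction on `H¹_cont(·, Ẑ(1))` IS the
completion of `Fˣ ⊆ Eˣ` under Kummer theory ([AbsTopIII] Cor. 1.10 (i)(b): `H¹(G_k, Ẑ(1)) = (kˣ)^∧`,
functorially in the open injection `Γ_E ↪ Γ_F`). [cite: MochizukiAbsTopIII2015, Cor 1.10 (i) p.42] -/
theorem completionEquiv_map_tate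
    {Ψ : completion (GrpCat.of Fˣ) →ₜ* completion (GrpCat.of Eˣ)}
    (hΨ : ∀ u : Fˣ, Ψ (etaFn (GrpCat.of Fˣ) u) = etaFn (GrpCat.of Eˣ) (Units.map (algebraMap F E : F →* E) u))
    (x : continuousCohomology 1 (tateModuleMu F).toTopRep) :
    continuousCohomologyOneTateModuleEquivCompletion E hfinE
        (ContinuousCohomology.map (absGaloisRestrict F E) f 1 x) =
      Additive.ofMul (Ψ (Additive.toMul (continuousCohomologyOneTateModuleEquivCompletion F hfinF x))) :=
  completionEquiv_map_tate_of_proj hfinF hfinE f hf Ψ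
    (fun z n => PowCompletion.proj_eq_of_eta hfinF hfinE (Units.map (algebraMap F E : F →* E)) hΨ z n) x

end Completion

end Literature.AnabelianGeometry.AbsoluteAnabelian
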